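import Literature.NumberTheory.EllipticCurves.BSDSelmerParityDokchitserProofs
import Literature.NumberTheory.EllipticCurves.ZpCorankQuasiIso
import Literature.NumberTheory.EllipticCurves.H1CorestrictionIndexTwo
import Literature.NumberTheory.EllipticCurves.SelmerPInftyRestriction
import Literature.NumberTheory.EllipticCurves.LocalRestrictionDegree
import Literature.NumberTheory.EllipticCurves.ArchimedeanLocalCondition
import Literature.NumberTheory.EllipticCurves.SelmerPInftyGaloisAction
import Literature.NumberTheory.EllipticCurves.SelmerPInftyModelAction
import Literature.NumberTheory.EllipticCurves.QuadraticTwistSelmerPInfty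
import Literature.NumberTheory.EllipticCurves.SelmerFiniteProofs
import HarnessLib

/-!
# Discharge of `selmerCorank_baseChange_quadratic` (the `p^∞`-Selmer rank over a quadratic field)

Sibling proof file of `Literature.NumberTheory.EllipticCurves.BSDSelmerParityDokchitserProofs`, which
states the named fact `Literature.NumberTheory.EllipticCurves.selmerCorank_baseChange_quadratic`:
for an elliptic curve `E/ℚ`, a quadratic number field `K = ℚ(√d_K)` and every prime `p`,
`corank_{ℤ_p} Sel_{p^∞}(E/K) = corank_{ℤ_p} Sel_{p^∞}(E/ℚ) + corank_{ℤ_p} Sel_{p^∞}(E^{(d_K)}/ℚ)`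
(T. Dokchitser, *Notes on the parity conjecture* (2013), §4, proof of the Theorem
"[Squarity, NekIV, Kurast]", first display, `rk_p(E/K(√α)) = rk_p(E/K) + rk_p(E_α/K)`; mechanism
T. Dokchitser–V. Dokchitser, Ann. of Math. 172 (2010), Lemma 4.14: restriction
`Sel_{p^∞}(E/K) → Sel_{p^∞}(E/F)^G` has kernel and cokernel killed by `|G|²`, so
`X_p(E/K) = X_p(E/F)^G`; with `F = K(√α)`, `X_p(E/F) = X⁺ ⊕ X⁻`, `X⁺ = X_p(E/K)` and, `E_α ≅ E`
over `F` with the Galois action twisted by the quadratic character, `X⁻ = X_p(E_α/K)`).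
This file proves `selmerCorank_baseChange_quadratic_holds` (all primes `p`, including `p = 2`).

## The proof

Everything is assembled from proved tree files (no named fact is used):

* the index-`2` corestriction and the `±`-decomposition up to bounded torsion on continuous `H¹`
  (`H1CorestrictionIndexTwo`: `IndexTwoDecompositionData`, kernel of
  `Φ : S × S' → T`, `(η, η') ↦ res η + ψ_* res η'` killed by `4`, `2^(a+1) T ⊆ im Φ`), fed with:
  `G = Γ_ℚ`, `N = galRange K ≅ Γ_K` (the subgroup model `modelIso` of `SelmerPInftyRestriction`,
  under which restriction `Sel_{p^∞}(E/ℚ) → Sel_{p^∞}(E/K)` is restriction to the subgroup),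
  `c` the transported lift of the non-trivial `σ₀ ∈ Gal(K/ℚ)`, `M = E[p^∞]`, `M' = E^{(c)}[p^∞]`
  (`K = ℚ(θ)`, `θ² = c`), `ψ : E^{(c)}[p^∞] ≃ E[p^∞]` the twist isomorphism over `K`
  (`QuadraticTwistSelmerPInfty`, `N`-equivariant and anti-equivariant at `c`:
  `twistIso_pointsMap_of_neg`), `S = Sel_{p^∞}(E/ℚ)`, `S' = Sel_{p^∞}(E^{(c)}/ℚ)` and `T` the image
  of the classes of `H¹(K, E[p^∞])` satisfying the Selmer conditions at the *finite* places
  (`finSelmerGroupPInfty`, stable under `σ₀`: `SelmerPInftyGaloisAction`, `SelmerPInftyModelAction`);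
  the torsion bound `a = 2`: if `res η` satisfies the finite conditions over `K` then `2 res η`
  satisfies all of them (`ArchimedeanLocalCondition`) and then `4η ∈ Sel_{p^∞}(E/ℚ)`
  (`LocalRestrictionDegree`: `[K_w : ℚ_v] ≤ 2` at every place);
* hence `Sel_{p^∞}(E/ℚ) × Sel_{p^∞}(E^{(c)}/ℚ) → Sel_{p^∞}(E/K)` has kernel killed by `4` and
  cokernel killed by `8`, so the coranks agree (`ZpCorankQuasiIso`: quasi-isomorphism invariance
  and additivity of the corank formula, for `p`-primary groups with finite `p`-torsion — the
  `p`-torsion of a `p^∞`-Selmer group being a quotient of the finite `p`-Selmer group,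
  `exists_mem_selmerGroup_torsionToPrimaryH1_eq`, Silverman X.4.2(b) `finite_selmerGroup_holds`);
* finally `E^{(d_K)} ≅ E^{(c)}` over `ℚ` (`d_K = c q²`), and isomorphic curves have equal Selmer
  coranks (`selmerCorank_eq_of_variableChange`).

## References

* [Dokchitser2013ParityNotes] T. Dokchitser, *Notes on the parity conjecture*, CRM Barcelona,
  Birkhäuser (2013) = arXiv:1009.5389, §4, proof of the Theorem "[Squarity, NekIV, Kurast]",
  display (Kalpha); Remark 5 (`X_p(E/K) = X_p(E/F)^{Gal(F/K)}`).
* [DokchitserDokchitserAnnals2010] T. Dokchitser, V. Dokchitser, *On the Birch–Swinnerton-Dyer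
  quotients modulo squares*, Ann. of Math. 172 (2010) = arXiv:math/0610290, Lemma 4.14 and §4.6.
* [SilvermanAEC2009] J. H. Silverman, *The Arithmetic of Elliptic Curves*, 2nd ed., X.2, X.4, X.5.
-/

noncomputable section

open scoped Classical AddSubgroup

namespace Literature.NumberTheory.EllipticCurves

open GaloisRepresentations WeierstrassCurve Literature.NumberTheory.QuadraticFields

/-! ## `H¹(K, E[p^∞])` is `p`-primary; the `p`-torsion of `Sel_{p^∞}` is finite -/

section Primary

variable {K : Type} [Field K] (W : WeierstrassCurve K) (p : ℕ)

/-- `H¹(K, E[p^∞])` is a `p`-primary group: a continuous cocycle on the compact `Γ_K` with values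
in the discrete `p`-primary `E[p^∞]` is killed by a single power of `p`.
Greenberg (1999), §2. [folklore] -/
theorem exists_pow_nsmul_eq_zero_galH1Primary [PerfectField K] (x : galH1Primary W p) :
    ∃ k : ℕ, p ^ k • x = 0 := by
  haveI : CompactSpace (Field.absoluteGaloisGroup K) := compactSpace_absoluteGaloisGroup K
  obtain ⟨f, rfl⟩ := oneCocycleClass_surjective _ x
  obtain ⟨k, hk⟩ := exists_pow_smul_apply_eq_zero f.1 fun g ↦ by
    obtain ⟨k, hk⟩ := AddCommGroup.mem_primaryComponent.mp (f.1 g).2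
    exact ⟨k, Subtype.ext (by rw [AddSubmonoidClass.coe_nsmul, hk, ZeroMemClass.coe_zero])⟩
  exact ⟨k, nsmul_oneCocycleClass_eq_zero f (p ^ k) hk⟩

variable [NumberField K] [W.IsElliptic]

/-- **The `p`-torsion of `Sel_{p^∞}(E/K)` is finite**: it is the image of the finite `p`-Selmer
group (`exists_mem_selmerGroup_torsionToPrimaryH1_eq`, Silverman X.4.2(b)
`finite_selmerGroup_holds`). Greenberg (1999), §1, p. 55 ("cofinitely generated"). [folklore] -/
theorem finite_torsionBy_selmerGroupPInfty [Fact p.Prime] :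
    Finite (selmerGroupPInfty W p)[(p : ℤ)] := by
  haveI : Finite (selmerGroup W (p : ℤ)) :=
    W.finite_selmerGroup_holds (Int.natCast_ne_zero.mpr (Fact.out : p.Prime).ne_zero)
  let g : selmerGroup W (p : ℤ) → (selmerGroupPInfty W p)[(p : ℤ)] := fun y ↦
    if h : torsionToPrimaryH1 W p y ∈ selmerGroupPInfty W p ∧ p • torsionToPrimaryH1 W p y = 0 then
      ⟨⟨torsionToPrimaryH1 W p y, h.1⟩, AddSubgroup.torsionBy.nsmul_iff.mpr (Subtype.ext (by
        rw [AddSubmonoidClass.coe_nsmul, ZeroMemClass.coe_zero]; exact h.2))⟩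
    else 0
  refine Finite.of_surjective g fun x ↦ ?_
  have hpx : p • ((x : selmerGroupPInfty W p) : galH1Primary W p) = 0 := by
    have h := congrArg (fun z : selmerGroupPInfty W p ↦ (z : galH1Primary W p))
      (AddSubgroup.torsionBy.nsmul_iff.mp x.2)
    simpa only [AddSubmonoidClass.coe_nsmul, ZeroMemClass.coe_zero] using h
  obtain ⟨y, hy, hyx⟩ := exists_mem_selmerGroup_torsionToPrimaryH1_eq W p
    W.zsmul_geomPoints_surjective_holds (x : selmerGroupPInfty W p).2 hpx
  refine ⟨⟨y, hy⟩, ?_⟩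
  have h : torsionToPrimaryH1 W p y ∈ selmerGroupPInfty W p ∧ p • torsionToPrimaryH1 W p y = 0 := by
    rw [hyx]; exact ⟨(x : selmerGroupPInfty W p).2, hpx⟩
  simp only [g, dif_pos h]
  exact Subtype.ext (Subtype.ext hyx)

end Primary

/-! ## The setting: `E/ℚ`, `K = ℚ(θ)` quadratic with `θ² = c`, a prime `p` -/

section Setting

variable (W : WeierstrassCurve ℚ) (K : Type) [Field K] [NumberField K] (h2 : Module.finrank ℚ K = 2)
  {θ : K} {c : ℚ} (hθ : θ ∉ Set.range (algebraMap ℚ K)) (hc : θ ^ 2 = algebraMap ℚ K c) (p : ℕ)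

/-- The non-trivial automorphism `σ₀ : a + bθ ↦ a - bθ` of the quadratic field `K = ℚ(θ)`
(`Quadratic.conj`, an involution). [folklore] -/
def sigmaQ : K ≃ₐ[ℚ] K :=
  AlgEquiv.ofAlgHom (Quadratic.conj h2 hθ hc) (Quadratic.conj h2 hθ hc)
    (AlgHom.ext fun x ↦ Quadratic.conj_conj h2 hθ hc x) (AlgHom.ext fun x ↦ Quadratic.conj_conj h2 hθ hc x)

/-- `σ₀ θ = -θ`. [folklore] -/
theorem sigmaQ_gen : sigmaQ K h2 hθ hc θ = -θ :=
  Quadratic.conj_gen h2 hθ hc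

/-- `σ₀ ≠ 1` (`θ ≠ 0`). [folklore] -/
theorem sigmaQ_ne_one : sigmaQ K h2 hθ hc ≠ 1 := by
  intro h
  have h1 : sigmaQ K h2 hθ hc θ = θ := by rw [h, AlgEquiv.one_apply]
  rw [sigmaQ_gen, neg_eq_iff_add_eq_zero, ← two_mul, mul_eq_zero] at h1
  rcases h1 with h1 | h1
  · exact two_ne_zero h1
  · exact Quadratic.ne_zero_of_not_mem_range hθ h1

include h2 in
/-- `K/ℚ` is Galois (quadratic). [folklore] -/
theorem isGalois_of_finrank_eq_two : IsGalois ℚ K :=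
  haveI : Algebra.IsQuadraticExtension ℚ K := ⟨h2⟩
  inferInstance

/-- The completed square `C • E = E^{(1)}` over `ℚ` (a chosen change of variables). [folklore] -/
def sqChange : VariableChange ℚ := Classical.choose W.exists_variableChange_quadraticTwist_one

/-- `sqChange W • W = W^{(1)}`. [folklore] -/
theorem sqChange_spec : sqChange W • W = W.quadraticTwist 1 :=
  Classical.choose_spec W.exists_variableChange_quadraticTwist_one

/-! ### The twist isomorphism on `E[p^∞]` over `K̄` and over `ℚ̄` -/

/-- The `K`-level twist isomorphism `E^{(c)}_K[p^∞] ≃+ E_K[p^∞]` (restriction of `twistIso` to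
`p`-primary parts, as the composite of the two single changes of variables). [folklore] -/
def psiK : geomPrimaryTorsion ((W.quadraticTwist c).baseChange K) p ≃+
    geomPrimaryTorsion (W.baseChange K) p :=
  (primaryIso p (twistUntwist_smul_baseChange W hθ hc)).trans
    (primaryIso p (map_smul_baseChange_eq_quadraticTwist_one W (sqChange_spec W) (K := K))).symm

/-- `psiK` is `twistIso` on underlying points. [folklore] -/
theorem coe_psiK (m : geomPrimaryTorsion ((W.quadraticTwist c).baseChange K) p) :
    (psiK W K hθ hc p m : geomPoints (W.baseChange K)) = twistIso W hθ hc (sqChange_spec W) m :=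
  rfl

/-- `psiK` is `Γ_K`-equivariant. [folklore] -/
theorem psiK_smul (g : Field.absoluteGaloisGroup K)
    (m : geomPrimaryTorsion ((W.quadraticTwist c).baseChange K) p) :
    psiK W K hθ hc p (g • m) = g • psiK W K hθ hc p m :=
  Subtype.ext (by
    rw [coe_psiK, primaryComponent.coe_smul, primaryComponent.coe_smul, coe_psiK, twistIso_smul])

/-- The `K`-level twist isomorphism on `H¹(K, ·[p^∞])` (composite of the two `h1PrimaryIso`).
[folklore] -/
def hPsiK : galH1Primary ((W.quadraticTwist c).baseChange K) p ≃+ galH1Primary (W.baseChange K) p :=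
  (h1PrimaryIso p (twistUntwist_smul_baseChange W hθ hc)).trans
    (h1PrimaryIso p (map_smul_baseChange_eq_quadraticTwist_one W (sqChange_spec W) (K := K))).symm

/-- `hPsiK` as one map of pairs: `resH1Hom (id, psiK)`. [folklore] -/
theorem hPsiK_apply (s : galH1Primary ((W.quadraticTwist c).baseChange K) p) :
    hPsiK W K hθ hc p s = resH1Hom (ContinuousMonoidHom.id _)
      (psiK W K hθ hc p).toAddMonoidHom (psiK_smul W K hθ hc p) s := by
  rw [hPsiK, AddEquiv.trans_apply, h1PrimaryIso, h1PrimaryIso]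
  change resH1Hom (ContinuousMonoidHom.id _) _ _ (h1Equiv _ _ s) = _
  rw [h1Equiv_apply, resH1Hom_resH1Hom]
  exact congrFun (congrArg DFunLike.coe (resH1Hom_congr (by ext; rfl) (by ext; rfl) _ _)) s

/-- `hPsiK` respects the `p^∞`-Selmer local condition at every `K`-field. [folklore] -/
theorem mem_selmerLocalKerPrimary_iff_hPsiK_mem (E : Type) [Field E] [Algebra K E]
    (s : galH1Primary ((W.quadraticTwist c).baseChange K) p) :
    s ∈ selmerLocalKerPrimary ((W.quadraticTwist c).baseChange K) E p ↔
      hPsiK W K hθ hc p s ∈ selmerLocalKerPrimary (W.baseChange K) E p := by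
  rw [hPsiK, AddEquiv.trans_apply,
    mem_selmerLocalKerPrimary_iff_h1PrimaryIso_mem E p (twistUntwist_smul_baseChange W hθ hc) s,
    mem_selmerLocalKerPrimary_iff_h1PrimaryIso_mem E p
      (map_smul_baseChange_eq_quadraticTwist_one W (sqChange_spec W) (K := K)),
    AddEquiv.apply_symm_apply]

/-- `hPsiK` respects the finite Selmer conditions. [folklore] -/
theorem mem_finSelmerGroupPInfty_iff_hPsiK_mem (s : galH1Primary ((W.quadraticTwist c).baseChange K) p) :
    s ∈ ((W.quadraticTwist c).baseChange K).finSelmerGroupPInfty p ↔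
      hPsiK W K hθ hc p s ∈ (W.baseChange K).finSelmerGroupPInfty p := by
  simp only [WeierstrassCurve.mem_finSelmerGroupPInfty_iff]
  exact forall_congr' fun v ↦ mem_selmerLocalKerPrimary_iff_hPsiK_mem W K hθ hc p _ s

/-- `hPsiK` respects `Sel_{p^∞}`. [folklore] -/
theorem mem_selmerGroupPInfty_iff_hPsiK_mem (s : galH1Primary ((W.quadraticTwist c).baseChange K) p) :
    s ∈ selmerGroupPInfty ((W.quadraticTwist c).baseChange K) p ↔
      hPsiK W K hθ hc p s ∈ selmerGroupPInfty (W.baseChange K) p := by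
  simp only [selmerGroupPInfty, AddSubgroup.mem_inf, AddSubgroup.mem_iInf]
  refine and_congr (forall_congr' fun v ↦ ?_) (forall_congr' fun w ↦ ?_)
  · exact mem_selmerLocalKerPrimary_iff_hPsiK_mem W K hθ hc p _ s
  · exact mem_selmerLocalKerPrimary_iff_hPsiK_mem W K hθ hc p _ s

/-- **The twist isomorphism `ψ : E^{(c)}[p^∞](ℚ̄) ≃+ E[p^∞](ℚ̄)`** in the `Γ_ℚ`-world: through the
coefficient isomorphisms `E^{(c)}[p^∞](ℚ̄) ≅ E^{(c)}_K[p^∞](K̄)`, `E[p^∞](ℚ̄) ≅ E_K[p^∞](K̄)`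
(`primaryBaseChangeEquiv`) it is `psiK`. [folklore] -/
def psiQ : geomPrimaryTorsion (W.quadraticTwist c) p ≃+ geomPrimaryTorsion W p :=
  (primaryBaseChangeEquiv K (W.quadraticTwist c) p).trans
    ((psiK W K hθ hc p).trans (primaryBaseChangeEquiv K W p).symm)

/-- Unfolding `psiQ`. [folklore] -/
theorem psiQ_apply (m' : geomPrimaryTorsion (W.quadraticTwist c) p) :
    psiQ W K hθ hc p m' = (primaryBaseChangeEquiv K W p).symm
      (psiK W K hθ hc p (primaryBaseChangeEquiv K (W.quadraticTwist c) p m')) :=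
  rfl

/-- **`ψ` is `galRange K`-equivariant** (`galRange K ≅ Γ_K` acts through `Γ_K`, and `psiK` is
`Γ_K`-equivariant). [folklore] -/
theorem psiQ_smul (n : galRange (K := ℚ) K) (m' : geomPrimaryTorsion (W.quadraticTwist c) p) :
    psiQ W K hθ hc p (n • m') = n • psiQ W K hθ hc p m' := by
  rw [psiQ_apply, psiQ_apply, ← resGalToRange_rangeToResGal K n, primaryBaseChangeEquiv_smul,
    psiK_smul, resGalToRange_rangeToResGal, ← primaryBaseChangeEquiv_symm_smul]

/-- **`ψ` is anti-equivariant at the transported lift `c₀` of `σ₀`**: `ψ (c₀ • m') = -(c₀ • ψ m')`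
— the sign rule `twistIso (τ₀ P) = -(τ₀ (twistIso P))` (`twistIso_pointsMap_of_neg`, `σ₀ θ = -θ`)
read through the coefficient isomorphisms (`primaryBaseChangeEquiv_smul_liftToAbsGal`). This is
"`E_α ≅ E` over `K(√α)`, with the Galois action twisted by the quadratic character"
(T. Dokchitser 2013, §4). [cite: Dokchitser2013ParityNotes, §4, proof of the Theorem "[Squarity, NekIV, Kurast]"] -/
theorem psiQ_smul_liftToAbsGal (m' : geomPrimaryTorsion (W.quadraticTwist c) p) :
    psiQ W K hθ hc p (liftToAbsGal (K := ℚ) K (sigmaQ K h2 hθ hc) • m') =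
      -(liftToAbsGal (K := ℚ) K (sigmaQ K h2 hθ hc) • psiQ W K hθ hc p m') := by
  apply (primaryBaseChangeEquiv K W p).injective
  rw [psiQ_apply, AddEquiv.apply_symm_apply, ← primaryBaseChangeEquiv_smul_liftToAbsGal, map_neg,
    ← primaryBaseChangeEquiv_smul_liftToAbsGal, psiQ_apply, AddEquiv.apply_symm_apply]
  apply Subtype.ext
  rw [coe_psiK, IsLiftOfAut.coe_primaryTorsionMap, NegMemClass.coe_neg,
    IsLiftOfAut.coe_primaryTorsionMap, coe_psiK]
  exact twistIso_pointsMap_of_neg W hθ hc (sqChange_spec W) (isLiftOfAut_liftAut _)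
    (sigmaQ_gen K h2 hθ hc) _

/-- **The key identity**: `ψ_* ∘ modelIso' = modelIso ∘ hPsiK` on `H¹(K, E^{(c)}_K[p^∞])` (both are
the map of the pair `(rangeToResGal, ψ ∘ ι'⁻¹ = ι⁻¹ ∘ psiK)`). [folklore] -/
theorem h1Equiv_psiQ_modelIso (y : galH1Primary ((W.quadraticTwist c).baseChange K) p) :
    h1Equiv (psiQ W K hθ hc p) (psiQ_smul W K hθ hc p) (modelIso K (W.quadraticTwist c) p y) =
      modelIso K W p (hPsiK W K hθ hc p y) := by
  rw [h1Equiv_apply, modelIso_apply, modelIso_apply, hPsiK_apply, resH1Hom_resH1Hom,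
    resH1Hom_resH1Hom]
  refine congrFun (congrArg DFunLike.coe (resH1Hom_congr (by ext; rfl) ?_ _ _)) y
  refine AddMonoidHom.ext fun m ↦ ?_
  change psiQ W K hθ hc p ((primaryBaseChangeEquiv K (W.quadraticTwist c) p).symm m) =
    (primaryBaseChangeEquiv K W p).symm (psiK W K hθ hc p m)
  rw [psiQ_apply, AddEquiv.apply_symm_apply]

end Setting

/-! ## The `±`-decomposition data and the corank identity for `E^{(c)}` -/

section Decomposition

open NumberField

variable (W : WeierstrassCurve ℚ) (K : Type) [Field K] [NumberField K] (h2 : Module.finrank ℚ K = 2)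
  {θ : K} {c : ℚ} (hθ : θ ∉ Set.range (algebraMap ℚ K)) (hc : θ ^ 2 = algebraMap ℚ K c) (p : ℕ)

include h2 in
/-- **If `res η` satisfies the finite Selmer conditions over `K` then `4η ∈ Sel_{p^∞}(E/ℚ)`**:
`2 res η = res (2η)` satisfies all conditions (the archimedean ones hold up to `2`,
`two_nsmul_mem_selmerLocalKerPrimary_infinitePlace`), so `2 · 2η ∈ Sel_{p^∞}(E/ℚ)`
(`two_nsmul_mem_selmerGroupPInfty_of_res_mem`, local degrees `≤ 2`).
[cite: DokchitserDokchitserAnnals2010, Lemma 4.14 (proof)] -/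
theorem four_nsmul_mem_selmerGroupPInfty_of_resPrimary_mem (X : WeierstrassCurve ℚ)
    {η : galH1Primary X p} (hη : resPrimary X K p η ∈ (X.baseChange K).finSelmerGroupPInfty p) :
    4 • η ∈ selmerGroupPInfty X p := by
  have h2η : resPrimary X K p (2 • η) ∈ selmerGroupPInfty (X.baseChange K) p := by
    rw [map_nsmul, WeierstrassCurve.selmerGroupPInfty_eq_finSelmerGroupPInfty_inf,
      AddSubgroup.mem_inf, AddSubgroup.mem_iInf]
    exact ⟨AddSubgroup.nsmul_mem _ hη 2,
      fun w ↦ two_nsmul_mem_selmerLocalKerPrimary_infinitePlace (X.baseChange K) p w _⟩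
  have h := two_nsmul_mem_selmerGroupPInfty_of_res_mem X K h2.le p (resPrimary X K p)
    (primaryH1ToH1_resPrimary X K p) h2η
  rwa [smul_smul] at h

/-- **The `±`-decomposition data** (`IndexTwoDecompositionData` of `H1CorestrictionIndexTwo`)
for `E/ℚ`, `K = ℚ(θ)`, `θ² = c`: `N = galRange K`, `c₀ = liftToAbsGal K σ₀`, `M = E[p^∞]`,
`M' = E^{(c)}[p^∞]`, `ψ = psiQ`, `S = Sel_{p^∞}(E/ℚ)`, `S' = Sel_{p^∞}(E^{(c)}/ℚ)`, `T` the image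
under `modelIso` of the finite Selmer conditions over `K`, `a = 2`.
[cite: DokchitserDokchitserAnnals2010, Lemma 4.14 (proof)] -/
def decompData :
    haveI : IsGalois ℚ K := isGalois_of_finrank_eq_two K h2
    haveI := normal_galRange K h2 (sigmaQ_ne_one K h2 hθ hc)
    IndexTwoDecompositionData (galRange (K := ℚ) K) (liftToAbsGal (K := ℚ) K (sigmaQ K h2 hθ hc))
      (geomPrimaryTorsion W p) (geomPrimaryTorsion (W.quadraticTwist c) p) := by
  haveI : IsGalois ℚ K := isGalois_of_finrank_eq_two K h2
  haveI := normal_galRange K h2 (sigmaQ_ne_one K h2 hθ hc)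
  exact
  { isOpen := isOpen_galRange K
    xor := xor_galRange K h2 (sigmaQ_ne_one K h2 hθ hc)
    continuous_smul := continuous_smul_geomPrimaryTorsion W p
    continuous_smul' := continuous_smul_geomPrimaryTorsion (W.quadraticTwist c) p
    ψ := psiQ W K hθ hc p
    hψ := psiQ_smul W K hθ hc p
    hψc := psiQ_smul_liftToAbsGal W K h2 hθ hc p
    S := selmerGroupPInfty W p
    S' := selmerGroupPInfty (W.quadraticTwist c) p
    T := ((W.baseChange K).finSelmerGroupPInfty p).map (modelIso K W p).toAddMonoidHom
    res_mem := fun η hη ↦ by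
      refine ⟨resPrimary W K p η, (W.baseChange K).selmerGroupPInfty_le_finSelmerGroupPInfty p
        (resPrimary_mem_selmerGroupPInfty W K p hη), ?_⟩
      rw [AddEquiv.coe_toAddMonoidHom, modelIso_resPrimary]
      rfl
    res_mem' := fun η' hη' ↦ by
      refine ⟨hPsiK W K hθ hc p (resPrimary (W.quadraticTwist c) K p η'), ?_, ?_⟩
      · exact (mem_finSelmerGroupPInfty_iff_hPsiK_mem W K hθ hc p _).mp
          (((W.quadraticTwist c).baseChange K).selmerGroupPInfty_le_finSelmerGroupPInfty p
            (resPrimary_mem_selmerGroupPInfty (W.quadraticTwist c) K p hη'))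
      · rw [AddEquiv.coe_toAddMonoidHom, ← h1Equiv_psiQ_modelIso, modelIso_resPrimary]
        rfl
    conj_mem := by
      rintro _ ⟨s, hs, rfl⟩
      exact ⟨(isLiftOfAut_liftAut (sigmaQ K h2 hθ hc)).conjH1Primary W p s,
        conjH1Primary_mem_finSelmerGroupPInfty W p _ hs,
        modelIso_conjH1Primary K W p (sigmaQ K h2 hθ hc) h2 (sigmaQ_ne_one K h2 hθ hc) s⟩
    a := 2
    mem_of_res_mem := by
      rintro η ⟨s, hs, hsη⟩
      apply four_nsmul_mem_selmerGroupPInfty_of_resPrimary_mem K h2 p W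
      have : modelIso K W p s = modelIso K W p (resPrimary W K p η) := by
        rw [AddEquiv.coe_toAddMonoidHom] at hsη
        rw [hsη, modelIso_resPrimary]; rfl
      rwa [← (modelIso K W p).injective this]
    mem_of_res_mem' := by
      rintro η' ⟨s, hs, hsη⟩
      apply four_nsmul_mem_selmerGroupPInfty_of_resPrimary_mem K h2 p (W.quadraticTwist c)
      rw [mem_finSelmerGroupPInfty_iff_hPsiK_mem W K hθ hc p]
      have : modelIso K W p s = modelIso K W p (hPsiK W K hθ hc p (resPrimary (W.quadraticTwist c) K p η')) := by
        rw [AddEquiv.coe_toAddMonoidHom] at hsη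
        rw [hsη, ← h1Equiv_psiQ_modelIso, modelIso_resPrimary]; rfl
      rwa [← (modelIso K W p).injective this] }

/-- **The comparison map** `Φ : Sel_{p^∞}(E/ℚ) × Sel_{p^∞}(E^{(c)}/ℚ) → Sel_{p^∞}(E/K)`,
`(η, η') ↦ res η + hPsiK (res η')` (restriction, and restriction of the twist followed by the
twist isomorphism over `K`). Dokchitser–Dokchitser 2010, proof of Lemma 4.14 with the twist.
[cite: DokchitserDokchitserAnnals2010, Lemma 4.14 (proof)] -/
def comparisonMap : selmerGroupPInfty W p × selmerGroupPInfty (W.quadraticTwist c) p →+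
    selmerGroupPInfty (W.baseChange K) p :=
  (((resPrimary W K p).comp (selmerGroupPInfty W p).subtype).coprod
    (((hPsiK W K hθ hc p).toAddMonoidHom.comp (resPrimary (W.quadraticTwist c) K p)).comp
      (selmerGroupPInfty (W.quadraticTwist c) p).subtype)).codRestrict _ (by
    rintro ⟨η, η'⟩
    exact AddSubgroup.add_mem _ (resPrimary_mem_selmerGroupPInfty W K p η.2)
      ((mem_selmerGroupPInfty_iff_hPsiK_mem W K hθ hc p _).mp
        (resPrimary_mem_selmerGroupPInfty (W.quadraticTwist c) K p η'.2)))

/-- `modelIso ∘ comparisonMap = decompMap` of the decomposition data. [folklore] -/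
theorem modelIso_comparisonMap (x : selmerGroupPInfty W p × selmerGroupPInfty (W.quadraticTwist c) p) :
    haveI : IsGalois ℚ K := isGalois_of_finrank_eq_two K h2
    haveI := normal_galRange K h2 (sigmaQ_ne_one K h2 hθ hc)
    modelIso K W p (comparisonMap W K hθ hc p x : galH1Primary (W.baseChange K) p) =
      ((decompData W K h2 hθ hc p).decompMap x :
        subgroupH1 (galRange (K := ℚ) K) (geomPrimaryTorsion W p)) := by
  haveI : IsGalois ℚ K := isGalois_of_finrank_eq_two K h2
  haveI := normal_galRange K h2 (sigmaQ_ne_one K h2 hθ hc)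
  rw [IndexTwoDecompositionData.coe_decompMap_apply]
  change modelIso K W p (resPrimary W K p x.1 +
      hPsiK W K hθ hc p (resPrimary (W.quadraticTwist c) K p x.2)) =
    resSubgroupH1 (galRange (K := ℚ) K) (geomPrimaryTorsion W p) x.1 +
      h1Equiv (psiQ W K hθ hc p) (psiQ_smul W K hθ hc p)
        (resSubgroupH1 (galRange (K := ℚ) K) (geomPrimaryTorsion (W.quadraticTwist c) p) x.2)
  rw [map_add, ← h1Equiv_psiQ_modelIso, modelIso_resPrimary, modelIso_resPrimary]
  rfl

include h2 in
/-- **The kernel of the comparison map is killed by `4`** (hence by `8`).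
[cite: DokchitserDokchitserAnnals2010, Lemma 4.14 (proof)] -/
theorem nsmul_eq_zero_of_comparisonMap_eq_zero
    (x : selmerGroupPInfty W p × selmerGroupPInfty (W.quadraticTwist c) p)
    (hx : comparisonMap W K hθ hc p x = 0) : 8 • x = 0 := by
  haveI : IsGalois ℚ K := isGalois_of_finrank_eq_two K h2
  haveI := normal_galRange K h2 (sigmaQ_ne_one K h2 hθ hc)
  have h0 : (decompData W K h2 hθ hc p).decompMap x = 0 := by
    apply Subtype.ext
    rw [← modelIso_comparisonMap, hx, ZeroMemClass.coe_zero, map_zero, ZeroMemClass.coe_zero]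
  have h4 := (decompData W K h2 hθ hc p).nsmul_eq_zero_of_decompMap_eq_zero x h0
  have h4' : (4 : ℕ) • x = 0 := h4
  rw [show (8 : ℕ) • x = 2 • (4 • x) by rw [smul_smul]; norm_num, h4', smul_zero]

include h2 in
/-- **The cokernel of the comparison map is killed by `8`**.
[cite: DokchitserDokchitserAnnals2010, Lemma 4.14 (proof)] -/
theorem nsmul_mem_range_comparisonMap (s : selmerGroupPInfty (W.baseChange K) p) :
    8 • s ∈ (comparisonMap W K hθ hc p).range := by
  haveI : IsGalois ℚ K := isGalois_of_finrank_eq_two K h2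
  haveI := normal_galRange K h2 (sigmaQ_ne_one K h2 hθ hc)
  set D := decompData W K h2 hθ hc p with hD
  have hsT : modelIso K W p s ∈ D.T :=
    ⟨s, (W.baseChange K).selmerGroupPInfty_le_finSelmerGroupPInfty p s.2, rfl⟩
  obtain ⟨x, hx⟩ := D.pow_nsmul_mem_range_decompMap ⟨_, hsT⟩
  refine ⟨x, ?_⟩
  apply Subtype.ext
  apply (modelIso K W p).injective
  have hx' := congrArg Subtype.val hx
  rw [← modelIso_comparisonMap W K h2 hθ hc p x] at hx'
  rw [hx', AddSubmonoidClass.coe_nsmul, AddSubmonoidClass.coe_nsmul, map_nsmul]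
  rfl

variable [hp : Fact p.Prime] [W.IsElliptic]

include h2 hθ hc in
/-- **`rk_p(E/K) = rk_p(E/ℚ) + rk_p(E^{(c)}/ℚ)`** for `K = ℚ(θ)`, `θ² = c` and every prime `p`:
the comparison map is a quasi-isomorphism (kernel and cokernel killed by `8`) between
`p`-primary groups with finite `p`-torsion, so the coranks agree
(`zpCorank_eq_of_nsmul_ker_of_nsmul_coker`, `zpCorank_prod`).
[cite: Dokchitser2013ParityNotes, §4, proof of the Theorem "[Squarity, NekIV, Kurast]"] -/
theorem selmerCorank_baseChange_eq_add :
    (W.baseChange K).selmerCorank p =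
      W.selmerCorank p + (W.quadraticTwist c).selmerCorank p := by
  have hc0 : c ≠ 0 := by
    rintro rfl
    apply Quadratic.ne_zero_of_not_mem_range hθ
    have : θ ^ 2 = 0 := by rw [hc, map_zero]
    exact pow_eq_zero_iff (n := 2) (by norm_num) |>.mp this
  haveI : (W.quadraticTwist c).IsElliptic := W.isElliptic_quadraticTwist hc0
  haveI : (W.baseChange K).IsElliptic := by rw [baseChange]; infer_instance
  -- the three Selmer groups: `p`-primary with finite `p`-torsion
  set S := selmerGroupPInfty W p
  set S' := selmerGroupPInfty (W.quadraticTwist c) p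
  set SK := selmerGroupPInfty (W.baseChange K) p
  have hS : ∀ x : S, ∃ k : ℕ, p ^ k • x = 0 := fun x ↦ by
    obtain ⟨k, hk⟩ := exists_pow_nsmul_eq_zero_galH1Primary W p (x : galH1Primary W p)
    exact ⟨k, Subtype.ext (by rw [AddSubmonoidClass.coe_nsmul, hk, ZeroMemClass.coe_zero])⟩
  have hS' : ∀ x : S', ∃ k : ℕ, p ^ k • x = 0 := fun x ↦ by
    obtain ⟨k, hk⟩ := exists_pow_nsmul_eq_zero_galH1Primary (W.quadraticTwist c) p
      (x : galH1Primary (W.quadraticTwist c) p)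
    exact ⟨k, Subtype.ext (by rw [AddSubmonoidClass.coe_nsmul, hk, ZeroMemClass.coe_zero])⟩
  have hSK : ∀ x : SK, ∃ k : ℕ, p ^ k • x = 0 := fun x ↦ by
    obtain ⟨k, hk⟩ := exists_pow_nsmul_eq_zero_galH1Primary (W.baseChange K) p
      (x : galH1Primary (W.baseChange K) p)
    exact ⟨k, Subtype.ext (by rw [AddSubmonoidClass.coe_nsmul, hk, ZeroMemClass.coe_zero])⟩
  haveI : Finite S[(p : ℤ)] := finite_torsionBy_selmerGroupPInfty W p
  haveI : Finite S'[(p : ℤ)] := finite_torsionBy_selmerGroupPInfty (W.quadraticTwist c) p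
  haveI : Finite SK[(p : ℤ)] := finite_torsionBy_selmerGroupPInfty (W.baseChange K) p
  -- the product
  have hprod := primary_and_finite_torsionBy_of_shortExact (p := p) (i := AddMonoidHom.inl S S')
    (f := AddMonoidHom.snd S S') (fun a b h ↦ (Prod.ext_iff.mp h).1)
    (fun b hb ↦ ⟨b.1, Prod.ext rfl (by simpa using hb.symm)⟩) (fun _ ↦ rfl) hS hS'
  haveI := hprod.2
  -- quasi-isomorphism invariance and additivity
  have hq := zpCorank_eq_of_nsmul_ker_of_nsmul_coker (comparisonMap W K hθ hc p) hprod.1 hSK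
    (N := 8) (by norm_num) (fun x hx ↦ nsmul_eq_zero_of_comparisonMap_eq_zero W K h2 hθ hc p x hx)
    (nsmul_mem_range_comparisonMap W K h2 hθ hc p)
  rw [zpCorank_prod hS hS'] at hq
  exact hq.symm

end Decomposition

/-! ## Discharge -/

/-- **Discharge of `selmerCorank_baseChange_quadratic`** (T. Dokchitser, *Notes on the parity
conjecture* (2013), §4, proof of the Theorem "[Squarity, NekIV, Kurast]", first display:
`rk_p(E/K(√α)) = rk_p(E/K) + rk_p(E_α/K)`, specialised to `K = ℚ`; mechanism Dokchitser–Dokchitser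
2010, Lemma 4.14): for an elliptic curve `E/ℚ`, a quadratic number field `K` and every prime `p`,
`corank_{ℤ_p} Sel_{p^∞}(E/K) = corank_{ℤ_p} Sel_{p^∞}(E/ℚ) + corank_{ℤ_p} Sel_{p^∞}(E^{(d_K)}/ℚ)`.
Proof: write `K = ℚ(θ)`, `θ² = c` (`Quadratic.exists_sq_eq_algebraMap`); then
`selmerCorank_baseChange_eq_add` gives the identity with `E^{(c)}`, and `E^{(d_K)} ≅ E^{(c)}`
over `ℚ` since `d_K = c q²` (`NumberField.exists_discr_eq_mul_sq`,
`exists_variableChange_quadraticTwist_mul_sq`, `selmerCorank_eq_of_variableChange`).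
[cite: Dokchitser2013ParityNotes, §4, proof of the Theorem "[Squarity, NekIV, Kurast]", first display] [cite: DokchitserDokchitserAnnals2010, Lemma 4.14] -/
theorem selmerCorank_baseChange_quadratic_holds : selmerCorank_baseChange_quadratic := by
  intro W _ K _ _ h2 p _
  obtain ⟨θ, c, hθ, hc⟩ := Quadratic.exists_sq_eq_algebraMap (F := ℚ) (K := K) h2
  obtain ⟨q, hq, hd⟩ := NumberField.exists_discr_eq_mul_sq h2 hθ hc
  obtain ⟨C, hC⟩ := W.exists_variableChange_quadraticTwist_mul_sq c q hq
  rw [← hd] at hC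
  rw [selmerCorank_baseChange_eq_add W K h2 hθ hc p, selmerCorank_eq_of_variableChange p hC]

end Literature.NumberTheory.EllipticCurves
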